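/-
Copyright (c) 2026 the pub-hodgecm-mathlib formalisation cell (harness21).  Prover seat hodgecm-mathlib-A-p12 (g25): road «S3-ram» (LEAD F0P3a-plan (g13); (Cnt2′) chair
F0P3a-p07 (g15) RULING (13) organ (4b); (α) keeper F0P3a-p06 (g16)); organ (K4a) of the (4b) decomposition, PART 1/3; 2026-09-02.
-/
import Literature.NumberTheory.Rogawski1990.DepthZeroKappaTransferOddLevelTokenSlices            -- ★ (K2) (this seat, p849143): brings ★ (K1), ★ `pairing_coe_mulVec_single_eq_inv_mul_mul_apply`, ★ `coe_inv_mul_mul_sub_one`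
import Literature.NumberTheory.Automorphic.UnitaryLatticeTreeFixedStar                            -- ★ `mapGL_N₁_eq_mapGL_N₁_iff` (same neighbour ↔ same residual point)
import Literature.NumberTheory.Automorphic.UnitaryLatticeTreeTypeTwoNormalForm                     -- ★ `firstColumn_props` (the first column of `κ ∈ K₀` is integral, isotropic, primitive)
import HarnessLib

/-!
# The ramified `κ`-orbital integral: THE EIGENLINE CLAUSE OF A CHILD AS A CONGRUENCE ON ITS LINE (organ (4b), part (K4a) 1/3)
# (Kottwitz 1986 §3; Bruhat–Tits 1972 §10; Tits 1979 §3.5)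

Topic `NumberTheory/Rogawski1990`; namespace `Literature.NumberTheory.Rogawski1990.TypeOneRamifiedJunction` (the raw head's).  THEOREMS ONLY (no definition, no instance, no
notation, no named fact, no `sorry`); kernel lane `--supports stmt-HodgeConjecture-24833`; datum-free (`K` with `Valued K ℤᵐ⁰`).  Cell `pub/hodgecm-mathlib` (D-0151), crux
H413; road «S3-ram» (count-neutral); (Cnt2′) ROUTE B, chair RULING (13) organ **(4b) «PER-KIND VALUES over the W-ball»** (A-p12 (g25)), part (K4a) = the per-vertex token
census of a block literal; THIS FILE (1/3) is its generic half about the EIGENLINE CLAUSE of ★ (K2) `offRegion_tokenSlices_of_lineCounts_of_odd` (`|M′₁₀|, |M′₂₀| ≤ |ϖ|^{d+1}`,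
`M′ = (uκ)⁻¹(γ−1)(uκ)`, for the child `(uκ)·N₁` of `v = u·r₀`, any `γ ∈ U(σ,J₀)`):
* §1 **`eigenline_iff_exists_congr`**: eigenline ⟺ `∃ c, M·x ≡ c·x (mod ϖ^{d+1}𝒪³)` for `x = κe₀`, `M = ↑(u⁻¹γu) − 1` (`M′e₀ = κ⁻¹(Mx)`, `κ ∈ GL₃(𝒪)`; pure matrix form
  `apply_one_zero_le_and_apply_two_zero_le_iff_exists_congr`); **`eigenline_iff_of_latticeGraphIso_eq`**: the clause does not depend on the representative `κ` of the child
  (`(uκ)N₁ = (uκ′)N₁ ⟺ κ′e₀ ≡ c₀κe₀ (mod 𝔪)`, ★ `mapGL_N₁_eq_mapGL_N₁_iff`; the congruence survives since `|M| ≤ |ϖ|^d` and `|c| ≤ |ϖ|^d` by primitivity of `x`).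
* §0 `v_inv_pow_mul_lt_one_iff` (`|ϖ^{−d}z| < 1 ⟺ |z| ≤ |ϖ|^{d+1}`), `v_le_of_mul_le_of_not_lt`.
* §2 **`not_eigenline_of_unit_value`**: a child whose depth-`d` line value lies in a unit class is not an eigenline (the value is `ϖ^{−d}M′₂₀`).
Parts 2/3 (`…TypeTwoRamifiedBlockVertexEigenlines`: parent ∕ block neighbour ∕ shell ∕ inner) and 3/3 (`…TypeTwoRamifiedBlockVertexCensus`: the counts) follow.
HONEST LABEL: HC_CM is proved only modulo the 2 remaining named inputs (hLiu418 24832, h413 24833) until rung 0 closes; nothing printed is asserted here (lattice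
bookkeeping over ★ results); «S3-ram» is Literature seeding, count-neutral.

## References
* [Kottwitz1986] R. E. Kottwitz, *Base change for unit elements of Hecke algebras*, Compositio Math. 60 (1986), §3 (counting fixed lattices shell by shell).
* [Rogawski1990] J. D. Rogawski, *Automorphic Representations of Unitary Groups in Three Variables*, Ann. of Math. Stud. 123 (1990), §4.8 Case (a) p. 53, §4.9 pp. 54–56, Prop. 4.9.1 (b).
* [BruhatTits1972] F. Bruhat, J. Tits, *Groupes réductifs sur un corps local I*, Publ. Math. IHÉS 41 (1972), §10 (lattice models of the building).
* [Tits1979] J. Tits, *Reductive groups over local fields*, PSPM 33.1 (1979), §3.5.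
* [Serre1980Trees] J.-P. Serre, *Trees* (1980), Ch. II §1.1.
-/

set_option autoImplicit false

noncomputable section

open scoped Valued WithZero Matrix MatrixGroups
open Polynomial Classical SimpleGraph
open Literature.NumberTheory.Automorphic Literature.NumberTheory.Automorphic.HermitianLattice Literature.NumberTheory.Automorphic.UnitaryLatticeTree
open Literature.Combinatorics.SimpleGraph.TreeLayers

namespace Literature.NumberTheory.Rogawski1990.TypeOneRamifiedJunction

variable {K : Type*} [Field K] [Valued K ℤᵐ⁰] {σ : K →+* K} {ϖ : K}

/-! ## §1 Eigenline ⟺ a congruence on the line; independence of the representative -/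

omit [Valued K ℤᵐ⁰] in
/-- Bookkeeping: `(kI·X·kM) i 0 = (kI ·(X ·(kM e₀))) i`. [cite: Tits1979, §3.5] -/
theorem mul_mul_apply_zero_eq_mulVec (kI X kM : Matrix (Fin 3) (Fin 3) K) (i : Fin 3) :
    (kI * X * kM) i 0 = (kI *ᵥ (X *ᵥ (kM *ᵥ Pi.single 0 1))) i := by
  rw [Matrix.mulVec_mulVec, Matrix.mulVec_mulVec, Matrix.mulVec_single_one]
  rfl

/-- An `s`-bounded matrix maps `t`-small vectors to `s·t`-small vectors (ultrametric). [cite: Serre1980Trees, Ch. II §1.1] -/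
theorem v_mulVec_apply_le_mul_of_forall_le {A : Matrix (Fin 3) (Fin 3) K} {s : ℤᵐ⁰} (hA : ∀ i j, Valued.v (A i j) ≤ s) {r : Fin 3 → K} {t : ℤᵐ⁰}
    (hr : ∀ i, Valued.v (r i) ≤ t) (i : Fin 3) : Valued.v ((A *ᵥ r) i) ≤ s * t := by
  rw [Matrix.mulVec, dotProduct]
  refine Valuation.map_sum_le _ fun j _ => ?_
  rw [map_mul]
  exact mul_le_mul' (hA i j) (hr j)

/-- **EIGENLINE ⟺ CONGRUENCE ON THE LINE (matrix form).**  For `kM` invertible with inverse `kI`, both integral, any `M` and any bound `t`: the first column of `kI·M·kM` has its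
entries `1, 2` bounded by `t` iff `M·x ≡ c·x` up to `t` for `x = kM·e₀` and some `c` (namely `c = (kI M kM)₀₀`). [cite: Tits1979, §3.5] [cite: BruhatTits1972, §10] -/
theorem apply_one_zero_le_and_apply_two_zero_le_iff_exists_congr {kM kI : Matrix (Fin 3) (Fin 3) K} (hkk : kM * kI = 1) (hkk' : kI * kM = 1)
    (hkMi : ∀ i j, Valued.v (kM i j) ≤ 1) (hkIi : ∀ i j, Valued.v (kI i j) ≤ 1) (M : Matrix (Fin 3) (Fin 3) K) (t : ℤᵐ⁰) :
    (Valued.v ((kI * M * kM) 1 0) ≤ t ∧ Valued.v ((kI * M * kM) 2 0) ≤ t) ↔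
      ∃ c : K, ∀ i, Valued.v ((M *ᵥ (kM *ᵥ Pi.single 0 1)) i - c * (kM *ᵥ Pi.single 0 1) i) ≤ t := by
  obtain ⟨x, hx⟩ : ∃ x : Fin 3 → K, x = kM *ᵥ Pi.single 0 1 := ⟨_, rfl⟩
  obtain ⟨z, hz⟩ : ∃ z : Fin 3 → K, z = kI *ᵥ (M *ᵥ x) := ⟨_, rfl⟩
  have hcol : ∀ i, (kI * M * kM) i 0 = z i := fun i => by rw [hz, hx]; exact mul_mul_apply_zero_eq_mulVec kI M kM i
  have hMx : M *ᵥ x = kM *ᵥ z := by rw [hz, Matrix.mulVec_mulVec, hkk, Matrix.one_mulVec]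
  rw [← hx, hcol 1, hcol 2]
  constructor
  · rintro ⟨h1, h2⟩
    refine ⟨z 0, fun i => ?_⟩
    -- `Mx − z₀·x = kM·(z − z₀e₀)`, and `z − z₀e₀ = (0, z₁, z₂)` is `t`-small
    have hdec : (M *ᵥ x) i - z 0 * x i = (kM *ᵥ (z - z 0 • (Pi.single 0 1 : Fin 3 → K))) i := by
      rw [Matrix.mulVec_sub, Matrix.mulVec_smul, ← hMx, ← hx, Pi.sub_apply, Pi.smul_apply, smul_eq_mul]
    rw [hdec]
    refine (one_mul t).le.trans' (v_mulVec_apply_le_mul_of_forall_le hkMi (fun j => ?_) i)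
    fin_cases j
    · simp
    · simpa using h1
    · simpa using h2
  · rintro ⟨c, hc⟩
    -- `z − c e₀ = kI·(Mx − c x)` is `t`-small; its entries `1, 2` are the two entries in question
    have hxback : kI *ᵥ x = Pi.single 0 1 := by rw [hx, Matrix.mulVec_mulVec, hkk', Matrix.one_mulVec]
    have hdec : ∀ i, z i - c * (Pi.single 0 (1 : K) : Fin 3 → K) i = (kI *ᵥ ((M *ᵥ x) - c • x)) i := by
      intro i
      rw [Matrix.mulVec_sub, Matrix.mulVec_smul, hxback, hz, Pi.sub_apply, Pi.smul_apply, smul_eq_mul]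
    have hsmall : ∀ i, Valued.v (z i - c * (Pi.single 0 (1 : K) : Fin 3 → K) i) ≤ t := fun i => by
      rw [hdec i]
      exact (one_mul t).le.trans' (v_mulVec_apply_le_mul_of_forall_le hkIi (fun j => by rw [Pi.sub_apply, Pi.smul_apply, smul_eq_mul]; exact hc j) i)
    refine ⟨?_, ?_⟩
    · simpa using hsmall 1
    · simpa using hsmall 2

omit [Valued K ℤᵐ⁰] in
/-- `(uκ)⁻¹(γ−1)(uκ) = κ⁻¹·(↑(u⁻¹γu) − 1)·κ` on matrices. [cite: Tits1979, §3.5] -/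
theorem coe_conj_mul_sub_one_eq (u γ κ : unitaryGroupOfForm σ ((StdForm.antidiagonal 3).over K)) :
    ((((((u * κ : unitaryGroupOfForm σ ((StdForm.antidiagonal 3).over K)) : GL (Fin 3) K))⁻¹ : GL (Fin 3) K) : Matrix (Fin 3) (Fin 3) K) * (((γ : GL (Fin 3) K) : Matrix (Fin 3) (Fin 3) K) - 1) * (((u * κ : unitaryGroupOfForm σ ((StdForm.antidiagonal 3).over K)) : GL (Fin 3) K) : Matrix (Fin 3) (Fin 3) K)) =
      ((((κ : GL (Fin 3) K))⁻¹ : GL (Fin 3) K) : Matrix (Fin 3) (Fin 3) K) *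
        ((((u⁻¹ * γ * u : unitaryGroupOfForm σ ((StdForm.antidiagonal 3).over K)) : GL (Fin 3) K) : Matrix (Fin 3) (Fin 3) K) - 1) * ((κ : GL (Fin 3) K) : Matrix (Fin 3) (Fin 3) K) := by
  rw [coe_inv_mul_mul_sub_one, Subgroup.coe_mul, mul_inv_rev, Units.val_mul, Units.val_mul]
  simp only [Matrix.mul_assoc]

/-- **EIGENLINE ⟺ CONGRUENCE ON THE LINE.**  `u, γ ∈ U(σ,J₀)`, `κ ∈ K₀`, `M := ↑(u⁻¹γu) − 1`, `x := κe₀`, `M′ := (uκ)⁻¹(γ−1)(uκ) = κ⁻¹Mκ`: the line of the child `(uκ)·N₁` is a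
first-order eigenline at level `d` (`|M′₁₀|, |M′₂₀| ≤ |ϖ|^(d+1)`) iff **`∃ c, ∀ i, |(M·x)ᵢ − c·xᵢ| ≤ |ϖ|^(d+1)`**. [cite: Tits1979, §3.5] [cite: BruhatTits1972, §10] -/
theorem eigenline_iff_exists_congr (u γ : unitaryGroupOfForm σ ((StdForm.antidiagonal 3).over K)) {κ : unitaryGroupOfForm σ ((StdForm.antidiagonal 3).over K)} (hκ : κ ∈ unitaryInt σ ((StdForm.antidiagonal 3).over K)) (d : ℕ) :
    (Valued.v (((((((u * κ : unitaryGroupOfForm σ ((StdForm.antidiagonal 3).over K)) : GL (Fin 3) K))⁻¹ : GL (Fin 3) K) : Matrix (Fin 3) (Fin 3) K) * (((γ : GL (Fin 3) K) : Matrix (Fin 3) (Fin 3) K) - 1) * (((u * κ : unitaryGroupOfForm σ ((StdForm.antidiagonal 3).over K)) : GL (Fin 3) K) : Matrix (Fin 3) (Fin 3) K)) 1 0) ≤ Valued.v ϖ ^ (d + 1) ∧ Valued.v (((((((u * κ : unitaryGroupOfForm σ ((StdForm.antidiagonal 3).over K)) : GL (Fin 3) K))⁻¹ : GL (Fin 3)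 K) : Matrix (Fin 3) (Fin 3) K) * (((γ : GL (Fin 3) K) : Matrix (Fin 3) (Fin 3) K) - 1) * (((u * κ : unitaryGroupOfForm σ ((StdForm.antidiagonal 3).over K)) : GL (Fin 3) K) : Matrix (Fin 3) (Fin 3) K)) 2 0) ≤ Valued.v ϖ ^ (d + 1)) ↔
    ∃ c : K, ∀ i, Valued.v ((((((u⁻¹ * γ * u : unitaryGroupOfForm σ ((StdForm.antidiagonal 3).over K)) : GL (Fin 3) K) : Matrix (Fin 3) (Fin 3) K) - 1) *ᵥ
        (((κ : GL (Fin 3) K) : Matrix (Fin 3) (Fin 3) K) *ᵥ Pi.single 0 1)) i - c * (((κ : GL (Fin 3) K) : Matrix (Fin 3) (Fin 3) K) *ᵥ Pi.single 0 1) i) ≤ Valued.v ϖ ^ (d + 1) := by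
  rw [coe_conj_mul_sub_one_eq u γ κ]
  exact apply_one_zero_le_and_apply_two_zero_le_iff_exists_congr
    (by rw [← Units.val_mul, mul_inv_cancel, Units.val_one]) (by rw [← Units.val_mul, inv_mul_cancel, Units.val_one])
    (mem_unitaryInt_iff.1 hκ).1 (mem_unitaryInt_iff.1 hκ).2 _ _


/-- **THE EIGENLINE CLAUSE DOES NOT DEPEND ON THE REPRESENTATIVE OF THE CHILD** (one direction): if `κ′e₀ ≡ c₀·κe₀ (mod 𝔪)` for a unit `c₀` (★ `mapGL_N₁_eq_mapGL_N₁_iff`: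
this is `(uκ)·N₁ = (uκ′)·N₁`) and `|M| ≤ |ϖ|^d`, then an eigenline congruence `Mx ≡ c·x (mod ϖ^(d+1))` for `x = κe₀` gives one for `x′ = κ′e₀` (with the same `c`; `|c| ≤ |ϖ|^d`
by primitivity of `x`). [cite: BruhatTits1972, §10] [cite: Tits1979, §3.5] -/
theorem eigenline_of_eigenline_of_congr (hϖ : Valued.v ϖ = WithZero.exp (-1 : ℤ))
    (u γ : unitaryGroupOfForm σ ((StdForm.antidiagonal 3).over K)) {κ κ' : unitaryGroupOfForm σ ((StdForm.antidiagonal 3).over K)} (hκ : κ ∈ unitaryInt σ ((StdForm.antidiagonal 3).over K)) (hκ' : κ' ∈ unitaryInt σ ((StdForm.antidiagonal 3).over K))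
    {d : ℕ} (hdeep : ∀ i j, Valued.v (((((u⁻¹ * γ * u : unitaryGroupOfForm σ ((StdForm.antidiagonal 3).over K)) : GL (Fin 3) K) : Matrix (Fin 3) (Fin 3) K) - 1) i j) ≤ Valued.v ϖ ^ d)
    {c₀ : K} (hc₀ : Valued.v c₀ = 1)
    (hcong : ∀ i, Valued.v (((κ' : GL (Fin 3) K) : Matrix (Fin 3) (Fin 3) K) i 0 - c₀ * ((κ : GL (Fin 3) K) : Matrix (Fin 3) (Fin 3) K) i 0) < 1)
    (hE : (Valued.v (((((((u * κ : unitaryGroupOfForm σ ((StdForm.antidiagonal 3).over K)) : GL (Fin 3) K))⁻¹ : GL (Fin 3) K) : Matrix (Fin 3) (Fin 3) K) * (((γ : GL (Fin 3) K) : Matrix (Fin 3) (Fin 3) K) - 1) * (((u * κ : unitaryGroupOfForm σ ((StdForm.antidiagonal 3).over K)) : GL (Fin 3) K) : Matrix (Fin 3) (Fin 3) K)) 1 0) ≤ Valued.v ϖ ^ (d + 1) ∧ Valued.v (((((((u * κ : unitaryGroupOfForm σ ((StdForm.antidiagonal 3).over K)) : GL (Fin 3) K))⁻¹ : GL (Fin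 3) K) : Matrix (Fin 3) (Fin 3) K) * (((γ : GL (Fin 3) K) : Matrix (Fin 3) (Fin 3) K) - 1) * (((u * κ : unitaryGroupOfForm σ ((StdForm.antidiagonal 3).over K)) : GL (Fin 3) K) : Matrix (Fin 3) (Fin 3) K)) 2 0) ≤ Valued.v ϖ ^ (d + 1))) : (Valued.v (((((((u * κ' : unitaryGroupOfForm σ ((StdForm.antidiagonal 3).over K)) : GL (Fin 3) K))⁻¹ : GL (Fin 3) K) : Matrix (Fin 3) (Fin 3) K) * (((γ : GL (Fin 3) K) : Matrix (Fin 3) (Fin 3) K) - 1) * (((u * κ' : unitaryGroupOfForm σ ((StdForm.antidiagonal 3).over K)) : GL (Fin 3) K) : Matrix (Fin 3) (Fin 3) K)) 1 0) ≤ Valued.v ϖ ^ (d + 1) ∧ Valued.v (((((((u * κ' : unitaryGroupOfForm σ ((StdForm.antidiagonal 3).over K)) : GL (Fin 3) K))⁻¹ : GL (Fin 3) K) : Matrix (Fin 3) (Fin 3) K) * (((γ : GL (Fin 3) K) : Matrix (Fin 3) (Fin 3) K) - 1) * (((u * κ' : unitaryGroupOfForm σ ((StdForm.antidiagonal 3).over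 K)) : GL (Fin 3) K) : Matrix (Fin 3) (Fin 3) K)) 2 0) ≤ Valued.v ϖ ^ (d + 1)) := by
  have hϖ1 : Valued.v ϖ ≤ 1 := by rw [hϖ, ← WithZero.exp_zero]; exact WithZero.exp_le_exp.2 (by norm_num)
  have hκi := (mem_unitaryInt_iff.1 hκ).1
  obtain ⟨c, hc⟩ := (eigenline_iff_exists_congr u γ hκ d).1 hE
  refine (eigenline_iff_exists_congr u γ hκ' d).2 ⟨c, fun i => ?_⟩
  -- coordinates: `x = κe₀`, `x′ = κ′e₀ = c₀x + y` with `|y| ≤ |ϖ|`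
  have hxi : ∀ (g : unitaryGroupOfForm σ ((StdForm.antidiagonal 3).over K)) (i : Fin 3), (((g : GL (Fin 3) K) : Matrix (Fin 3) (Fin 3) K) *ᵥ Pi.single 0 1) i = ((g : GL (Fin 3) K) : Matrix (Fin 3) (Fin 3) K) i 0 :=
    fun g i => by rw [Matrix.mulVec_single_one]; rfl
  obtain ⟨y, hy⟩ : ∃ y : Fin 3 → K, y = (((κ' : GL (Fin 3) K) : Matrix (Fin 3) (Fin 3) K) *ᵥ Pi.single 0 1) - c₀ • (((κ : GL (Fin 3) K) : Matrix (Fin 3) (Fin 3) K) *ᵥ Pi.single 0 1) := ⟨_, rfl⟩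
  have hyle : ∀ j, Valued.v (y j) ≤ Valued.v ϖ := fun j => by
    have h := hcong j
    rw [v_lt_one_iff, ← hϖ] at h
    rw [hy, Pi.sub_apply, Pi.smul_apply, smul_eq_mul, hxi, hxi]
    exact h
  have hx' : (((κ' : GL (Fin 3) K) : Matrix (Fin 3) (Fin 3) K) *ᵥ Pi.single 0 1) = c₀ • (((κ : GL (Fin 3) K) : Matrix (Fin 3) (Fin 3) K) *ᵥ Pi.single 0 1) + y := by
    rw [hy]; abel
  -- `|c| ≤ |ϖ|^d`: read `Mx ≡ cx` at a unit coordinate of the primitive `x`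
  obtain ⟨-, -, i₀, hi₀⟩ := firstColumn_props hκ
  have hMx : ∀ j, Valued.v ((((((u⁻¹ * γ * u : unitaryGroupOfForm σ ((StdForm.antidiagonal 3).over K)) : GL (Fin 3) K) : Matrix (Fin 3) (Fin 3) K) - 1) *ᵥ (((κ : GL (Fin 3) K) : Matrix (Fin 3) (Fin 3) K) *ᵥ Pi.single 0 1)) j) ≤ Valued.v ϖ ^ d := fun j => by
    have hxle : ∀ k, Valued.v ((((κ : GL (Fin 3) K) : Matrix (Fin 3) (Fin 3) K) *ᵥ Pi.single 0 1) k) ≤ 1 := fun k => by rw [hxi]; exact hκi k 0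
    have h := v_mulVec_apply_le_mul_of_forall_le hdeep hxle j
    rwa [mul_one] at h
  have hcle : Valued.v c ≤ Valued.v ϖ ^ d := by
    have e : c = ((((((u⁻¹ * γ * u : unitaryGroupOfForm σ ((StdForm.antidiagonal 3).over K)) : GL (Fin 3) K) : Matrix (Fin 3) (Fin 3) K) - 1) *ᵥ (((κ : GL (Fin 3) K) : Matrix (Fin 3) (Fin 3) K) *ᵥ Pi.single 0 1)) i₀ -
        ((((((u⁻¹ * γ * u : unitaryGroupOfForm σ ((StdForm.antidiagonal 3).over K)) : GL (Fin 3) K) : Matrix (Fin 3) (Fin 3) K) - 1) *ᵥ (((κ : GL (Fin 3) K) : Matrix (Fin 3) (Fin 3) K) *ᵥ Pi.single 0 1)) i₀ - c * (((κ : GL (Fin 3) K) : Matrix (Fin 3) (Fin 3) K) *ᵥ Pi.single 0 1) i₀)) *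
        ((((κ : GL (Fin 3) K) : Matrix (Fin 3) (Fin 3) K) *ᵥ Pi.single 0 1) i₀)⁻¹ := by
      have h0 : (((κ : GL (Fin 3) K) : Matrix (Fin 3) (Fin 3) K) *ᵥ Pi.single 0 1) i₀ ≠ 0 := fun h0 => by
        rw [h0, map_zero] at hi₀; exact zero_ne_one hi₀
      field_simp
      ring
    rw [e, map_mul, map_inv₀, hi₀, inv_one, mul_one]
    exact (Valuation.map_sub _ _ _).trans (max_le (hMx i₀) ((hc i₀).trans (pow_le_pow_right_of_le_one' hϖ1 (Nat.le_succ d))))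
  -- `Mx′ − c x′ = c₀·(Mx − c x) + (My − c y)`
  have e : (((((u⁻¹ * γ * u : unitaryGroupOfForm σ ((StdForm.antidiagonal 3).over K)) : GL (Fin 3) K) : Matrix (Fin 3) (Fin 3) K) - 1) *ᵥ (((κ' : GL (Fin 3) K) : Matrix (Fin 3) (Fin 3) K) *ᵥ Pi.single 0 1)) i - c * (((κ' : GL (Fin 3) K) : Matrix (Fin 3) (Fin 3) K) *ᵥ Pi.single 0 1) i =
      c₀ * ((((((u⁻¹ * γ * u : unitaryGroupOfForm σ ((StdForm.antidiagonal 3).over K)) : GL (Fin 3) K) : Matrix (Fin 3) (Fin 3) K) - 1) *ᵥ (((κ : GL (Fin 3) K) : Matrix (Fin 3) (Fin 3) K) *ᵥ Pi.single 0 1)) i - c * (((κ : GL (Fin 3) K) : Matrix (Fin 3) (Fin 3) K) *ᵥ Pi.single 0 1) i) +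
        ((((((u⁻¹ * γ * u : unitaryGroupOfForm σ ((StdForm.antidiagonal 3).over K)) : GL (Fin 3) K) : Matrix (Fin 3) (Fin 3) K) - 1) *ᵥ y) i - c * y i) := by
    rw [hx', Matrix.mulVec_add, Matrix.mulVec_smul, Pi.add_apply, Pi.add_apply, Pi.smul_apply, Pi.smul_apply, smul_eq_mul, smul_eq_mul]
    ring
  rw [e]
  refine (Valuation.map_add _ _ _).trans (max_le ?_ ?_)
  · rw [map_mul, hc₀, one_mul]; exact hc i
  · refine (Valuation.map_sub _ _ _).trans (max_le ?_ ?_)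
    · rw [pow_succ]; exact v_mulVec_apply_le_mul_of_forall_le hdeep hyle i
    · rw [map_mul, pow_succ]; exact mul_le_mul' hcle (hyle i)

/-- **REPRESENTATIVE-INDEPENDENCE OF THE EIGENLINE CLAUSE**: if `(uκ)·N₁ = (uκ′)·N₁` (`κ, κ′ ∈ K₀`) then the child's line is an eigenline for `κ` iff for `κ′`.
[cite: BruhatTits1972, §10] [cite: Tits1979, §3.5] -/
theorem eigenline_iff_of_latticeGraphIso_eq (hvσ : ∀ a, Valued.v (σ a) = Valued.v a) (hσϖ : σ ϖ = -ϖ) (hϖ : Valued.v ϖ = WithZero.exp (-1 : ℤ))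
    (u γ : unitaryGroupOfForm σ ((StdForm.antidiagonal 3).over K)) {κ κ' : unitaryGroupOfForm σ ((StdForm.antidiagonal 3).over K)} (hκ : κ ∈ unitaryInt σ ((StdForm.antidiagonal 3).over K)) (hκ' : κ' ∈ unitaryInt σ ((StdForm.antidiagonal 3).over K))
    {d : ℕ} (hdeep : ∀ i j, Valued.v (((((u⁻¹ * γ * u : unitaryGroupOfForm σ ((StdForm.antidiagonal 3).over K)) : GL (Fin 3) K) : Matrix (Fin 3) (Fin 3) K) - 1) i j) ≤ Valued.v ϖ ^ d)
    (heq : latticeGraphIso σ ϖ ((StdForm.antidiagonal 3).over K) (u * κ) ⟨latt (Matrix.diagonal ![(1 : K), 1, ϖ]), 2, isVertexLattice_two_N₁_of_neg hσϖ hϖ⟩ = latticeGraphIso σ ϖ ((StdForm.antidiagonal 3).over K) (u * κ') ⟨latt (Matrix.diagonal ![(1 : K), 1, ϖ]), 2, isVertexLattice_two_N₁_of_neg hσϖ hϖ⟩) :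
    (Valued.v (((((((u * κ : unitaryGroupOfForm σ ((StdForm.antidiagonal 3).over K)) : GL (Fin 3) K))⁻¹ : GL (Fin 3) K) : Matrix (Fin 3) (Fin 3) K) * (((γ : GL (Fin 3) K) : Matrix (Fin 3) (Fin 3) K) - 1) * (((u * κ : unitaryGroupOfForm σ ((StdForm.antidiagonal 3).over K)) : GL (Fin 3) K) : Matrix (Fin 3) (Fin 3) K)) 1 0) ≤ Valued.v ϖ ^ (d + 1) ∧ Valued.v (((((((u * κ : unitaryGroupOfForm σ ((StdForm.antidiagonal 3).over K)) : GL (Fin 3) K))⁻¹ : GL (Fin 3) K) : Matrix (Fin 3) (Fin 3) K) * (((γ : GL (Fin 3) K) : Matrix (Fin 3) (Fin 3) K) - 1) * (((u * κ : unitaryGroupOfForm σ ((StdForm.antidiagonal 3).over K)) : GL (Fin 3) K) : Matrix (Fin 3) (Fin 3) K)) 2 0) ≤ Valued.v ϖ ^ (d + 1)) ↔ (Valued.v (((((((u * κ' : unitaryGroupOfForm σ ((StdForm.antidiagonal 3).over K)) : GL (Fin 3) K))⁻¹ : GL (Fin 3) K) : Matrix (Fin 3) (Fin 3) K) * (((γ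 : GL (Fin 3) K) : Matrix (Fin 3) (Fin 3) K) - 1) * (((u * κ' : unitaryGroupOfForm σ ((StdForm.antidiagonal 3).over K)) : GL (Fin 3) K) : Matrix (Fin 3) (Fin 3) K)) 1 0) ≤ Valued.v ϖ ^ (d + 1) ∧ Valued.v (((((((u * κ' : unitaryGroupOfForm σ ((StdForm.antidiagonal 3).over K)) : GL (Fin 3) K))⁻¹ : GL (Fin 3) K) : Matrix (Fin 3) (Fin 3) K) * (((γ : GL (Fin 3) K) : Matrix (Fin 3) (Fin 3) K) - 1) * (((u * κ' : unitaryGroupOfForm σ ((StdForm.antidiagonal 3).over K)) : GL (Fin 3) K) : Matrix (Fin 3) (Fin 3) K)) 2 0) ≤ Valued.v ϖ ^ (d + 1)) := by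
  -- cancel `u`, read the equality of neighbours as a unit congruence of the first columns (★ `mapGL_N₁_eq_mapGL_N₁_iff`)
  rw [latticeGraphIso_mul_apply, latticeGraphIso_mul_apply] at heq
  have heq' := (latticeGraphIso σ ϖ ((StdForm.antidiagonal 3).over K) u).injective heq
  have hmap : mapGL (κ : GL (Fin 3) K) (latt (Matrix.diagonal ![(1 : K), 1, ϖ])) = mapGL (κ' : GL (Fin 3) K) (latt (Matrix.diagonal ![(1 : K), 1, ϖ])) := by
    have h := congrArg Subtype.val heq'
    rwa [latticeGraphIso_apply_val, latticeGraphIso_apply_val] at h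
  constructor
  · intro hE
    obtain ⟨c₀, hc₀, hcong⟩ := (mapGL_N₁_eq_mapGL_N₁_iff hvσ hϖ hκ hκ').1 hmap.symm
    exact eigenline_of_eigenline_of_congr hϖ u γ hκ hκ' hdeep hc₀ hcong hE
  · intro hE
    obtain ⟨c₀, hc₀, hcong⟩ := (mapGL_N₁_eq_mapGL_N₁_iff hvσ hϖ hκ' hκ).1 hmap
    exact eigenline_of_eigenline_of_congr hϖ u γ hκ' hκ hdeep hc₀ hcong hE

/-! ## §0 The discrete reading of a strict inequality at scale `ϖ^d` -/

/-- `|ϖ^{−d}·z| < 1 ⟺ |z| ≤ |ϖ|^(d+1)` (discrete valuation, `|ϖ| = exp(−1)`). [cite: Serre1980Trees, Ch. II §1.1] -/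
theorem v_inv_pow_mul_lt_one_iff (hϖ : Valued.v ϖ = WithZero.exp (-1 : ℤ)) (d : ℕ) (z : K) :
    Valued.v ((ϖ ^ d)⁻¹ * z) < 1 ↔ Valued.v z ≤ Valued.v ϖ ^ (d + 1) := by
  have hvϖ0 : Valued.v ϖ ≠ 0 := by rw [hϖ]; exact WithZero.coe_ne_zero
  have hpow0 : Valued.v ϖ ^ d ≠ 0 := pow_ne_zero _ hvϖ0
  rw [v_lt_one_iff, ← hϖ, map_mul, map_inv₀, map_pow, pow_succ]
  constructor
  · intro h
    have h' := mul_le_mul' (le_refl (Valued.v ϖ ^ d)) h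
    rwa [← mul_assoc, mul_inv_cancel₀ hpow0, one_mul] at h'
  · intro h
    have h' := mul_le_mul' (le_refl (Valued.v ϖ ^ d)⁻¹) h
    rwa [← mul_assoc, inv_mul_cancel₀ hpow0, one_mul] at h'

/-- `¬ |ϖ^{−d}·z| < 1` together with `|z| ≤ |ϖ|^d` means `|z| = |ϖ|^d` EXACTLY, and then `|z·y| ≤ |ϖ|^(d+1) ⟹ |y| ≤ |ϖ|`. [cite: Serre1980Trees, Ch. II §1.1] -/
theorem v_le_of_mul_le_of_not_lt (hϖ : Valued.v ϖ = WithZero.exp (-1 : ℤ)) {d : ℕ} {z y : K}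
    (hz : ¬ Valued.v ((ϖ ^ d)⁻¹ * z) < 1) (h : Valued.v (z * y) ≤ Valued.v ϖ ^ (d + 1)) : Valued.v y ≤ Valued.v ϖ := by
  have hvϖ0 : Valued.v ϖ ≠ 0 := by rw [hϖ]; exact WithZero.coe_ne_zero
  have hpow0 : Valued.v ϖ ^ d ≠ 0 := pow_ne_zero _ hvϖ0
  rw [map_mul, map_inv₀, map_pow, not_lt] at hz
  -- `|ϖ|^d ≤ |z|`
  have hz' : Valued.v ϖ ^ d ≤ Valued.v z := by
    have h' := mul_le_mul' (le_refl (Valued.v ϖ ^ d)) hz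
    rwa [mul_one, ← mul_assoc, mul_inv_cancel₀ hpow0, one_mul] at h'
  rw [map_mul, pow_succ] at h
  by_contra hy
  rw [not_le] at hy
  have : Valued.v ϖ ^ d * Valued.v ϖ < Valued.v z * Valued.v y :=
    mul_lt_mul_of_le_of_lt_of_nonneg_of_pos hz' hy zero_le (lt_of_lt_of_le (zero_lt_iff.2 hpow0) hz')
  exact absurd h (not_le.2 this)

/-! ## §2 A unit value is never an eigenline -/

/-- **A CHILD WITH A UNIT LINE VALUE IS NOT AN EIGENLINE**: the value `ϖ^{−d}·B₀(κe₀, M·κe₀)` is `ϖ^{−d}·M′₂₀` (★ `pairing_coe_mulVec_single_eq_inv_mul_mul_apply`), and an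
eigenline has `|M′₂₀| ≤ |ϖ|^(d+1)`. [cite: Kottwitz1986, §3] [cite: Tits1979, §3.5] -/
theorem not_eigenline_of_unit_value (hϖ : Valued.v ϖ = WithZero.exp (-1 : ℤ))
    (u γ κ : unitaryGroupOfForm σ ((StdForm.antidiagonal 3).over K)) (d : ℕ) {t : K} (ht : Valued.v t = 1)
    (hcls : ∃ a : K, Valued.v a = 1 ∧ Valued.v ((ϖ ^ d)⁻¹ * pairing σ ((StdForm.antidiagonal 3).over K) (((κ : GL (Fin 3) K) : Matrix (Fin 3) (Fin 3) K) *ᵥ Pi.single 0 1) (((((u⁻¹ * γ * u : unitaryGroupOfForm σ ((StdForm.antidiagonal 3).over K)) : GL (Fin 3) K) : Matrix (Fin 3) (Fin 3) K) - 1) *ᵥ (((κ : GL (Fin 3) K) : Matrix (Fin 3) (Fin 3) K) *ᵥ Pi.single 0 1)) - t * a ^ 2) < 1) :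
    ¬ (Valued.v (((((((u * κ : unitaryGroupOfForm σ ((StdForm.antidiagonal 3).over K)) : GL (Fin 3) K))⁻¹ : GL (Fin 3) K) : Matrix (Fin 3) (Fin 3) K) * (((γ : GL (Fin 3) K) : Matrix (Fin 3) (Fin 3) K) - 1) * (((u * κ : unitaryGroupOfForm σ ((StdForm.antidiagonal 3).over K)) : GL (Fin 3) K) : Matrix (Fin 3) (Fin 3) K)) 1 0) ≤ Valued.v ϖ ^ (d + 1) ∧ Valued.v (((((((u * κ : unitaryGroupOfForm σ ((StdForm.antidiagonal 3).over K)) : GL (Fin 3) K))⁻¹ : GL (Fin 3) K) : Matrix (Fin 3) (Fin 3) K) * (((γ : GL (Fin 3) K) : Matrix (Fin 3) (Fin 3) K) - 1) * (((u * κ : unitaryGroupOfForm σ ((StdForm.antidiagonal 3).over K)) : GL (Fin 3) K) : Matrix (Fin 3) (Fin 3) K)) 2 0) ≤ Valued.v ϖ ^ (d + 1)) := by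
  rintro ⟨-, h20⟩
  obtain ⟨a, ha, hlt⟩ := hcls
  rw [pairing_coe_mulVec_single_eq_inv_mul_mul_apply κ, ← coe_conj_mul_sub_one_eq u γ κ] at hlt
  have hsmall : Valued.v ((ϖ ^ d)⁻¹ * ((((((u * κ : unitaryGroupOfForm σ ((StdForm.antidiagonal 3).over K)) : GL (Fin 3) K))⁻¹ : GL (Fin 3) K) : Matrix (Fin 3) (Fin 3) K) * (((γ : GL (Fin 3) K) : Matrix (Fin 3) (Fin 3) K) - 1) * (((u * κ : unitaryGroupOfForm σ ((StdForm.antidiagonal 3).over K)) : GL (Fin 3) K) : Matrix (Fin 3) (Fin 3) K)) 2 0) < 1 := (v_inv_pow_mul_lt_one_iff hϖ d _).2 h20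
  have hta : Valued.v (t * a ^ 2) = 1 := by rw [map_mul, map_pow, ht, ha, one_pow, mul_one]
  have : Valued.v (t * a ^ 2) < 1 := by
    have e : t * a ^ 2 = (ϖ ^ d)⁻¹ * ((((((u * κ : unitaryGroupOfForm σ ((StdForm.antidiagonal 3).over K)) : GL (Fin 3) K))⁻¹ : GL (Fin 3) K) : Matrix (Fin 3) (Fin 3) K) * (((γ : GL (Fin 3) K) : Matrix (Fin 3) (Fin 3) K) - 1) * (((u * κ : unitaryGroupOfForm σ ((StdForm.antidiagonal 3).over K)) : GL (Fin 3) K) : Matrix (Fin 3) (Fin 3) K)) 2 0 - ((ϖ ^ d)⁻¹ * ((((((u * κ : unitaryGroupOfForm σ ((StdForm.antidiagonal 3).over K)) : GL (Fin 3) K))⁻¹ : GL (Fin 3) K) : Matrix (Fin 3) (Fin 3) K) * (((γ : GL (Fin 3) K) : Matrix (Fin 3) (Fin 3) K) - 1) * (((u * κ : unitaryGroupOfForm σ ((StdForm.antidiagonal 3).over K)) : GL (Fin 3) K) : Matrix (Fin 3) (Fin 3) K)) 2 0 - t * a ^ 2) := by ring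
    rw [e]
    exact lt_of_le_of_lt (Valuation.map_sub _ _ _) (max_lt hsmall hlt)
  exact absurd hta (ne_of_lt this)

end Literature.NumberTheory.Rogawski1990.TypeOneRamifiedJunction

end
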